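import Summits.BirchSwinnertonDyer.BirchSwinnertonDyer.Theorems.ErratumRoadFiveBigRepLocalInputs
import Literature.NumberTheory.EllipticCurves.CofreeContinuousRepNewform
import Literature.NumberTheory.GaloisRepresentations.ContinuousRepCoeffExtension
import Literature.NumberTheory.GaloisRepresentations.ArtinRestriction
import Literature.NumberTheory.GaloisRepresentations.DecompositionGroupOfCompletion
import Literature.NumberTheory.Automorphic.AdicCompletionLocalField
import HarnessLib

/-!
# K2 crux 20169 `IMCDivAtErratumDataAllR` (H3♭, re-oriented), ROAD FF v4 — stub 2, binder `e m`:
# the Lemma-2.1 divisibility hypotheses of `RoadFFMember.nonempty_memberCongruence` for the two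
# `𝒪`-coefficient Galois modules `𝒪 ⊗ E_K(K̄)[p^∞]` (the `E`-side) and `A_g = V_g/T_g` (the member)

Cell `bsd-stepL`, seat `bsd-stepL-imc-p1` (g9). `--supports stmt-BirchSwinnertonDyer-20169 --as helper`.
HONEST FRAMING: bookkeeping on tree objects; closes no item; no definition, no named fact, no `sorry`;
BSD is proved for no pair; no census number moves (T7).

## What this file proves

`RoadFFMember.nonempty_memberCongruence` (p502247) consumes, for `ρ𝒪` (intended
`((W.baseChange K).primaryTorsionGaloisRep p).extendScalars 𝒪_m` on `𝒪_m ⊗_{ℤ_p} E_K(K̄)[p^∞]`) and for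
`ρg = Δ.cofreeRepOver K` on `A_g`, three hypotheses each: `hdiv` (`Φ ↦ C(p) • Φ` onto on the big module),
`hglob` (global invariants `p^m`-divisible), `hloc` (constrained local invariants along `localMap K` on
`strictSet p 𝔮 Σ` `p^m`-divisible). imc-p1 g8 proved all three for the `ℤ_p`-side `E[p^∞]`
(`BigRep.hdiv/hglob/hloc_anticyclotomicBigRep`, p481719; generic criteria p479748/p480662). Here:

* §1 the **`𝒪`-COEFFICIENT `E`-SIDE** for any Weierstrass curve `W'/K`, any `ℤ_p`-algebra `𝒪` FREE as a
  `ℤ_p`-module: `hdiv_extendScalars` (from `p`-divisibility of `E(K̄)`, `CoeffExtension.exists_nsmul_eq`),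
  `hglob_extendScalars` (from "no nonzero `Γ_K`-fixed geometric `p`-torsion", through
  `ContinuousRep.forall_fixed_primary_eq_zero_extendScalars`), `hloc_extendScalars` (from "no nonzero
  `Γ_{K_𝔮}`-fixed geometric `p`-torsion", "inertia outside `Σ ∪ S_p` acts trivially on `E[p^∞]`" through
  `extendScalars_apply_eq_self`, and `p`-divisibility) — the same geometric hypotheses as g8's `ℤ_p`-side
  lemmas, so g8's dischargers (`hglob_geomPoints_of_irr`, `hdec_geomPoints_of_padicTorsion`,
  `hunr_primaryTorsionGaloisRep_of_hasGoodReductionAt`) feed them verbatim; and the fixed-`p`-torsion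
  statement `forall_fixed_torsion_eq_zero_extendScalars_of_geomPoints` the member side needs.
* §2 the **MEMBER SIDE, unconditional parts**: `cofree_divisible` (`A = Fⁿ/𝒪ⁿ` is `p`-divisible, `F` of
  characteristic `0`), `hdiv_cofreeRepOver`; **`cofreeRepOver_apply_eq_self_of_mem_absInertia`** —
  `A_g|_{Γ_K}` is unramified at every finite place `w` of `K` with `w ∤ M p` (`M` the
  level of `g`): `ρ_g` is unramified at the rational prime below `w` (`Δ.charpoly`), restriction to `Γ_K`
  preserves unramifiedness (`FramedGaloisRep.isUnramifiedAt_restrictField`), the local inertia group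
  `I_{K_w}` maps into the global inertia group at the chosen prime (`inertia_adicCompletionPrime_eq_map_
  absInertia`, Neukirch II (9.6)), and `ρ_g(τ) = 1` acts trivially on `Fⁿ/𝒪ⁿ`; packaged as the `hunr`
  hypothesis shape of `BigRep.divisibleInvariants_localMap_strictSet` in `hunr_cofreeRepOver`.
The member's `hglob`/`hloc` need the fixed-torsion inputs transported through the congruence (b) over
`Γ_K` (imc-p1 g9 `exists_torsionCongruence_baseChange`, p504901) and are assembled in the sequel.

References: [Castella2018Erratum] Lemma 2.1 and its proof (p. 2), proof of Thm. 1.1 (b) (p. 4);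
[Skinner2016PacificMC] §2.3 Lemma 2.3.1 (p. 180), §3.1 (b)(d); [EmertonPollackWeston2006] §3.1 (`A_f`,
`ρ_f` unramified outside `Np`); [NeukirchANT1999] Ch. II §9 Prop. (9.6); [SerreAbelianLadic1968] Ch. I §2.1.
-/

set_option autoImplicit false

noncomputable section

open scoped TensorProduct MatrixGroups ModularForm

open PowerSeries Field IsDedekindDomain NumberField CongruenceSubgroup
open Literature.NumberTheory.GaloisRepresentations Literature.NumberTheory.EllipticCurves
  Literature.NumberTheory.EllipticCurves.BigRepModule Literature.NumberTheory.EllipticCurves.BigGaloisRep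
  Literature.NumberTheory.EllipticCurves.GreenbergSelmer Literature.NumberTheory.EllipticCurves.ModularForms
  WeierstrassCurve

namespace Summit.BirchSwinnertonDyer.Rank1Residual.X11b.RoadFFMember

/-! ### §1 The `𝒪`-coefficient `E`-side `𝒪 ⊗_{ℤ_p} E(K̄)[p^∞]` -/

section OSide

variable {K : Type} [Field K] [NumberField K] {p : ℕ} [Fact p.Prime]
  (𝒪 : Type) [CommRing 𝒪] [Algebra ℤ_[p] 𝒪] [TopologicalSpace 𝒪]
  (W' : WeierstrassCurve K)
  [TopologicalSpace (PowerSeries 𝒪)]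
  [ContinuousSMul (PowerSeries 𝒪)
    (BigRepModule 𝒪 p (CoeffExtension ℤ_[p] 𝒪 (PrimaryTorsion W'.geomPoints p)))]

omit [NumberField K] [TopologicalSpace 𝒪] [TopologicalSpace (PowerSeries 𝒪)]
  [ContinuousSMul (PowerSeries 𝒪) (BigRepModule 𝒪 p (CoeffExtension ℤ_[p] 𝒪 (PrimaryTorsion W'.geomPoints p)))] in
/-- **`𝒪 ⊗ E[p^∞]` is `p`-divisible** when `E(K̄)` is (pure tensors, `CoeffExtension.exists_nsmul_eq`).
[cite: Skinner2016PacificMC, §2.3, proof of Lemma 2.3.1 (p. 180: `T ⊗ Λ^*` divisible)] -/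
theorem coeffExtension_divisible (hE : ∀ P : W'.geomPoints, ∃ Q : W'.geomPoints, p • Q = P) :
    ∀ x : CoeffExtension ℤ_[p] 𝒪 (PrimaryTorsion W'.geomPoints p),
      ∃ y : CoeffExtension ℤ_[p] 𝒪 (PrimaryTorsion W'.geomPoints p), p • y = x :=
  CoeffExtension.exists_nsmul_eq fun a =>
    BigRep.primaryTorsion_divisible_of_geomPoints_divisible W' hE a
      ⟨a.level, PrimaryTorsion.ext (by rw [PrimaryTorsion.val_nsmul, a.level_spec, PrimaryTorsion.val_zero])⟩

omit [NumberField K] [TopologicalSpace 𝒪] [TopologicalSpace (PowerSeries 𝒪)]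
  [ContinuousSMul (PowerSeries 𝒪) (BigRepModule 𝒪 p (CoeffExtension ℤ_[p] 𝒪 (PrimaryTorsion W'.geomPoints p)))] in
/-- **`hdiv` for `𝒪 ⊗ E[p^∞]`**: `Φ ↦ C(p) • Φ` is onto on the big module, from `p`-divisibility of `E(K̄)`.
[cite: Skinner2016PacificMC, §2.3, proof of Lemma 2.3.1 (p. 180)] [cite: Castella2018, §2.1 (`𝒜 = T ⊗ Λ^*`)] -/
theorem hdiv_extendScalars (hE : ∀ P : W'.geomPoints, ∃ Q : W'.geomPoints, p • Q = P) :
    Function.Surjective fun Φ : BigRepModule 𝒪 p (CoeffExtension ℤ_[p] 𝒪 (PrimaryTorsion W'.geomPoints p)) =>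
      (C (p : 𝒪) : PowerSeries 𝒪) • Φ :=
  BigRep.C_smul_surjective fun x _ => coeffExtension_divisible 𝒪 W' hE x

omit [NumberField K] [TopologicalSpace (PowerSeries 𝒪)]
  [ContinuousSMul (PowerSeries 𝒪) (BigRepModule 𝒪 p (CoeffExtension ℤ_[p] 𝒪 (PrimaryTorsion W'.geomPoints p)))] in
/-- **No nonzero fixed `p`-torsion in `𝒪 ⊗ E[p^∞]`** (for a family `(g i)` of elements of `Γ_K` acting
through `ρ_{E,p} ⊗ 1`) from "no nonzero `(g i)`-fixed geometric point `P` with `p P = O`", when `𝒪` is free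
over `ℤ_p` (`ContinuousRep.forall_fixed_torsion_eq_zero_extendScalars`; on `E[p^∞]` itself a fixed
`p`-power-torsion point vanishes by g8's `eq_zero_of_forall_fixed_of_torsionBy`).
[cite: Castella2018Erratum, Lemma 2.1, proof (p. 2)] [cite: Skinner2016PacificMC, §2.3 (`𝒪` free of finite rank over `ℤ_p`)] -/
theorem forall_fixed_torsion_eq_zero_extendScalars_of_geomPoints [Module.Free ℤ_[p] 𝒪] {ι' : Type*}
    (g : ι' → absoluteGaloisGroup K)
    (h0 : ∀ P : W'.geomPoints, (∀ i, g i • P = P) → p • P = 0 → P = 0) :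
    ∀ x : CoeffExtension ℤ_[p] 𝒪 (PrimaryTorsion W'.geomPoints p),
      (∀ i, ContinuousRep.extendScalars (R := ℤ_[p]) (G := absoluteGaloisGroup K)
          (A := PrimaryTorsion W'.geomPoints p) 𝒪 (W'.primaryTorsionGaloisRep p) (g i) x = x) →
      p • x = 0 → x = 0 :=
  ContinuousRep.forall_fixed_torsion_eq_zero_extendScalars 𝒪 (W'.primaryTorsionGaloisRep p) g
    fun a ha _ => BigRep.eq_zero_of_forall_fixed_of_torsionBy W' g h0 a fun i => by
      simpa only [WeierstrassCurve.primaryTorsionGaloisRep_apply] using ha i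

omit [NumberField K] [TopologicalSpace (PowerSeries 𝒪)]
  [ContinuousSMul (PowerSeries 𝒪) (BigRepModule 𝒪 p (CoeffExtension ℤ_[p] 𝒪 (PrimaryTorsion W'.geomPoints p)))] in
/-- The `p`-power form: no nonzero fixed `p`-power torsion in `𝒪 ⊗ E[p^∞]` from the geometric `p`-torsion
statement (`ContinuousRep.forall_fixed_primary_eq_zero_extendScalars`). [cite: Castella2018Erratum, Lemma 2.1, proof (p. 2)] -/
theorem forall_fixed_primary_eq_zero_extendScalars_of_geomPoints [Module.Free ℤ_[p] 𝒪] {ι' : Type*}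
    (g : ι' → absoluteGaloisGroup K)
    (h0 : ∀ P : W'.geomPoints, (∀ i, g i • P = P) → p • P = 0 → P = 0) :
    ∀ x : CoeffExtension ℤ_[p] 𝒪 (PrimaryTorsion W'.geomPoints p),
      (∀ i, ContinuousRep.extendScalars (R := ℤ_[p]) (G := absoluteGaloisGroup K)
          (A := PrimaryTorsion W'.geomPoints p) 𝒪 (W'.primaryTorsionGaloisRep p) (g i) x = x) →
      (∃ k : ℕ, p ^ k • x = 0) → x = 0 :=
  ContinuousRep.forall_fixed_primary_eq_zero_extendScalars 𝒪 (W'.primaryTorsionGaloisRep p) g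
    fun a ha _ => BigRep.eq_zero_of_forall_fixed_of_torsionBy W' g h0 a fun i => by
      simpa only [WeierstrassCurve.primaryTorsionGaloisRep_apply] using ha i

omit [NumberField K] in
/-- **`hglob` for `𝒪 ⊗ E[p^∞]`** (`𝒪` free over `ℤ_p`): the global invariants of
`AnticyclotomicBigGaloisRep κ (ρ_{E,p} ⊗ 1)` are `p^m`-divisible (they vanish), from "no nonzero `Γ_K`-fixed
geometric `p`-torsion" (`E(K)[p] = 0`). [cite: Castella2018Erratum, Lemma 2.1, proof (p. 2: "H⁰(K, M_g) = H⁰(K_∞, A_g) = 0")] -/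
theorem hglob_extendScalars [Module.Free ℤ_[p] 𝒪] (κ : ZpExtension K p)
    (hK : ∀ P : W'.geomPoints, (∀ σ : absoluteGaloisGroup K, σ • P = P) → p • P = 0 → P = 0) :
    ∀ m : ℕ, 1 ≤ m →
      ∀ x ∈ (AnticyclotomicBigGaloisRep κ (ContinuousRep.extendScalars (R := ℤ_[p])
          (G := absoluteGaloisGroup K) (A := PrimaryTorsion W'.geomPoints p) 𝒪
          (W'.primaryTorsionGaloisRep p))).toTopRep.ρ.invariants,
        ∃ x' ∈ (AnticyclotomicBigGaloisRep κ (ContinuousRep.extendScalars (R := ℤ_[p])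
          (G := absoluteGaloisGroup K) (A := PrimaryTorsion W'.geomPoints p) 𝒪
          (W'.primaryTorsionGaloisRep p))).toTopRep.ρ.invariants,
          (C (p : 𝒪) : PowerSeries 𝒪) ^ m • x' = x :=
  BigRep.divisibleInvariants_anticyclotomicBigGaloisRep κ _
    (forall_fixed_primary_eq_zero_extendScalars_of_geomPoints 𝒪 W' (fun σ : absoluteGaloisGroup K => σ) hK)

/-- **`hloc` for `𝒪 ⊗ E[p^∞]`** (`𝒪` free over `ℤ_p`) at `(localMap K, strictSet p 𝔮 Σ)`, from "no nonzero
`Γ_{K_𝔮}`-fixed geometric `p`-torsion" (`E(K_𝔮)[p] = 0`, i.e. (iv) when `K_𝔮 = ℚ_p`), "inertia at every finite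
`w ∉ Σ`, `w ∤ p` acts trivially on `E[p^∞]`" (good reduction outside `Σ ∪ S_p`) and `p`-divisibility of `E(K̄)`.
[cite: Castella2018Erratum, Lemma 2.1 and its proof (p. 2)] -/
theorem hloc_extendScalars [Module.Free ℤ_[p] 𝒪] (κ : ZpExtension K p) (𝔮 : HeightOneSpectrum (𝓞 K))
    (S : Set (HeightOneSpectrum (𝓞 K)))
    (hE : ∀ P : W'.geomPoints, ∃ Q : W'.geomPoints, p • Q = P)
    (h𝔮 : ∀ P : W'.geomPoints, (∀ σ : absoluteGaloisGroup (𝔮.adicCompletion K),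
        absGaloisRestrict K (𝔮.adicCompletion K) σ • P = P) → p • P = 0 → P = 0)
    (hunr : ∀ w : HeightOneSpectrum (𝓞 K), w ∉ S → ((p : ℕ) : 𝓞 K) ∉ w.asIdeal →
      ∀ σ : absoluteGaloisGroup (w.adicCompletion K), σ ∈ absInertia (w.adicCompletion K) →
        ∀ P : PrimaryTorsion W'.geomPoints p, absGaloisRestrict K (w.adicCompletion K) σ • P = P) :
    ∀ m : ℕ, 1 ≤ m → ∀ v ∈ strictSet p 𝔮 S,
      ∀ x ∈ (((AnticyclotomicBigGaloisRep κ (ContinuousRep.extendScalars (R := ℤ_[p])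
          (G := absoluteGaloisGroup K) (A := PrimaryTorsion W'.geomPoints p) 𝒪
          (W'.primaryTorsionGaloisRep p))).restrict (localMap K v)).toTopRep).ρ.invariants,
        ∃ x' ∈ (((AnticyclotomicBigGaloisRep κ (ContinuousRep.extendScalars (R := ℤ_[p])
          (G := absoluteGaloisGroup K) (A := PrimaryTorsion W'.geomPoints p) 𝒪
          (W'.primaryTorsionGaloisRep p))).restrict (localMap K v)).toTopRep).ρ.invariants,
          (C (p : 𝒪) : PowerSeries 𝒪) ^ m • x' = x :=
  BigRep.divisibleInvariants_localMap_strictSet κ _ 𝔮 S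
    (fun x _ => coeffExtension_divisible 𝒪 W' hE x)
    (forall_fixed_primary_eq_zero_extendScalars_of_geomPoints 𝒪 W'
      (fun σ : absoluteGaloisGroup (𝔮.adicCompletion K) => absGaloisRestrict K (𝔮.adicCompletion K) σ) h𝔮)
    (fun w hw hpw σ hσ x => ContinuousRep.extendScalars_apply_eq_self 𝒪 (W'.primaryTorsionGaloisRep p)
      (fun P => by rw [WeierstrassCurve.primaryTorsionGaloisRep_apply]; exact hunr w hw hpw σ hσ P) x)

end OSide

/-! ### §2 The member side `A_g = Fⁿ/𝒪ⁿ`: divisibility and unramifiedness outside `M p` -/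

section Cofree

variable {G : Type*} [Group G] [TopologicalSpace G] {𝒪 : Type*} [CommRing 𝒪] [TopologicalSpace 𝒪] {n : ℕ}
  (F : Type*) [Field F] [Algebra 𝒪 F] [CharZero F]

/-- **`A = Fⁿ/𝒪ⁿ` is `p`-divisible** for `F` of characteristic `0` (`x mod 𝒪ⁿ = p • (p⁻¹ x mod 𝒪ⁿ)`).
[cite: EmertonPollackWeston2006, §3.1 (`A_f = K/𝒪 ⊗ T_f`)] [cite: Skinner2016PacificMC, §2.3, proof of Lemma 2.3.1 (p. 180)] -/
theorem cofree_divisible (ρ : FramedRep G 𝒪 n) {p : ℕ} (hp : p ≠ 0) :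
    ∀ a : Cofree ρ F, ∃ b : Cofree ρ F, p • b = a := by
  intro a
  obtain ⟨x, rfl⟩ := cofreeMk_surjective F ρ a
  refine ⟨cofreeMk F ρ ((p : F)⁻¹ • x), ?_⟩
  rw [← map_nsmul, ← Nat.cast_smul_eq_nsmul F, smul_smul, mul_inv_cancel₀ (Nat.cast_ne_zero.mpr hp),
    one_smul]

end Cofree

section Member

variable {M : ℕ} {k : ℤ} {g : CuspForm (Gamma0 M) k} {p : ℕ} [Fact p.Prime]
  {ι : coeffField g →+* PadicAlgCl p} (Δ : OrdinaryNewformDatum g p ι)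
  (K : Type) [Field K] [NumberField K]

/-- **`hdiv` for `M_g = AnticyclotomicBigGaloisRep κ (A_g|_{Γ_K})`**: `Φ ↦ C(p) • Φ` is onto, `A_g` being
`p`-divisible. [cite: Skinner2016PacificMC, §2.3, proof of Lemma 2.3.1 (p. 180)] [cite: Castella2018Erratum, §2 (p. 2, `M_g`)] -/
theorem hdiv_cofreeRepOver :
    Function.Surjective fun Φ : BigRepModule (padicCoeffIntegers ι) p (Cofree Δ.ρ (padicCoeffField ι)) =>
      (C (p : padicCoeffIntegers ι) : PowerSeries (padicCoeffIntegers ι)) • Φ :=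
  BigRep.C_smul_surjective fun a _ =>
    cofree_divisible (padicCoeffField ι) Δ.ρ (Fact.out : p.Prime).ne_zero a

/-- An element `τ ∈ Γ_ℚ` with `ρ_g(τ) = 1` acts trivially on `A_g = Fⁿ/𝒪ⁿ`. [cite: EmertonPollackWeston2006, §3.1 ("with `G_ℚ`-action via `ρ_f`")] -/
theorem cofreeRep_apply_eq_self_of_apply_eq_one {τ : absoluteGaloisGroup ℚ} (hτ : Δ.ρ τ = 1)
    (a : Cofree Δ.ρ (padicCoeffField ι)) : Δ.cofreeRep τ a = a := by
  obtain ⟨x, rfl⟩ := cofreeMk_surjective (padicCoeffField ι) Δ.ρ a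
  rw [OrdinaryNewformDatum.cofreeRep_apply, smul_cofreeMk, fracRepresentation_apply_apply, hτ, Units.val_one,
    Matrix.map_one _ (map_zero _) (map_one _), Matrix.one_mulVec]

/-- The rational prime `ℓ_v` below a finite place `v` of `ℚ` lies in `v`. [folklore]
[cite: NeukirchANT1999, Ch. I §8 (primes of `ℤ` and places of `ℚ`)] -/
theorem natCast_primesEquiv_mem_asIdeal (v : HeightOneSpectrum (𝓞 ℚ)) :
    (((Rat.HeightOneSpectrum.primesEquiv v : Nat.Primes) : ℕ) : 𝓞 ℚ) ∈ v.asIdeal := by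
  have h : Rat.HeightOneSpectrum.natGenerator v ∣ Rat.HeightOneSpectrum.natGenerator v := dvd_rfl
  rw [Rat.HeightOneSpectrum.natGenerator_dvd_iff, Ideal.mem_map_of_equiv] at h
  obtain ⟨y, hy, hyv⟩ := h
  have hy' : y = ((Rat.HeightOneSpectrum.natGenerator v : ℕ) : 𝓞 ℚ) := by
    apply (Rat.IsIntegralClosure.intEquiv (𝓞 ℚ)).injective
    rw [hyv, map_natCast]
  rw [hy'] at hy
  exact hy

/-- **`A_g|_{Γ_K}` is unramified at every finite place `w ∤ M p` of `K`**: the inertia group `I_{K_w}`,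
restricted to `Γ_K` along the chosen `absGaloisRestrict K K_w` (defn-ty1's `localMap K (Sum.inr w)`), acts
trivially on `A_g` — `ρ_g` is unramified at the prime `ℓ ∤ M p` below `w` (`Δ.charpoly`), so is
`ρ_g|_{Γ_K}` at `w` (`FramedGaloisRep.isUnramifiedAt_restrictField`), and `res(I_{K_w})` is the inertia
group of the chosen prime `𝔓₀ ∣ w` (`inertia_adicCompletionPrime_eq_map_absInertia`, Neukirch II (9.6)).
[cite: EmertonPollackWeston2006, §3.1 (p. 17: `ρ_f` unramified at `ℓ ∤ Np`)] [cite: NeukirchANT1999, Ch. II §9 Prop. (9.6)]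
[cite: Castella2018Erratum, Lemma 2.1 (p. 2, "Σ contains all primes `v ∤ p` where `T_g` is ramified")] -/
theorem cofreeRepOver_apply_eq_self_of_mem_absInertia (w : HeightOneSpectrum (𝓞 K))
    (hMw : ((M : ℕ) : 𝓞 K) ∉ w.asIdeal) (hpw : ((p : ℕ) : 𝓞 K) ∉ w.asIdeal)
    {σ : absoluteGaloisGroup (w.adicCompletion K)} (hσ : σ ∈ absInertia (w.adicCompletion K))
    (a : Cofree Δ.ρ (padicCoeffField ι)) :
    Δ.cofreeRepOver K (absGaloisRestrict K (w.adicCompletion K) σ) a = a := by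
  -- the place `v` of `ℚ` below `w` and its prime `ℓ`
  set v : HeightOneSpectrum (𝓞 ℚ) := w.under (𝓞 ℚ) with hv
  have hvw : w.asIdeal.under (𝓞 ℚ) = v.asIdeal := rfl
  have hℓv := natCast_primesEquiv_mem_asIdeal v
  have hℓw : (((Rat.HeightOneSpectrum.primesEquiv v : Nat.Primes) : ℕ) : 𝓞 K) ∈ w.asIdeal := by
    have h : algebraMap (𝓞 ℚ) (𝓞 K) (((Rat.HeightOneSpectrum.primesEquiv v : Nat.Primes) : ℕ) : 𝓞 ℚ) ∈
        w.asIdeal := by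
      rw [← Ideal.mem_comap]; exact hℓv
    rwa [map_natCast] at h
  have hℓM : ¬ ((Rat.HeightOneSpectrum.primesEquiv v : Nat.Primes) : ℕ) ∣ M := by
    rintro ⟨c, hc⟩
    exact hMw (by rw [hc, Nat.cast_mul]; exact w.asIdeal.mul_mem_right _ hℓw)
  have hℓp : ((Rat.HeightOneSpectrum.primesEquiv v : Nat.Primes) : ℕ) ≠ p := by
    rintro h
    exact hpw (h ▸ hℓw)
  -- `ρ_g|_{Γ_K}` is unramified at `w`, hence kills `res(I_{K_w}) = I_{𝔓₀}`
  have hunr : (Δ.ρ.restrictField K).IsUnramifiedAt w :=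
    Δ.ρ.isUnramifiedAt_restrictField hvw (Δ.charpoly v hℓM hℓp).1
  have h1 : (Δ.ρ.restrictField K) (absGaloisRestrict K (w.adicCompletion K) σ) = 1 :=
    hunr _ (adicCompletionPrime_mem_primesAbove K w) _ (by
      rw [inertia_adicCompletionPrime_eq_map_absInertia]
      exact Subgroup.mem_map_of_mem _ hσ)
  rw [FramedGaloisRep.restrictField_apply] at h1
  rw [ContinuousRep.restrict_apply]
  exact cofreeRep_apply_eq_self_of_apply_eq_one Δ h1 a

/-- **The `hunr` hypothesis of `BigRep.divisibleInvariants_localMap_strictSet` for `A_g|_{Γ_K}`**, for any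
set `S` of places containing every `w ∣ M`: at every finite `w ∉ S` with `w ∤ p`, `I_{K_w}` acts trivially.
[cite: Castella2018Erratum, Lemma 2.1 (p. 2, "Σ contains all primes `v ∤ p` where `T_g` is ramified")] -/
theorem hunr_cofreeRepOver (S : Set (HeightOneSpectrum (𝓞 K)))
    (hSM : ∀ w : HeightOneSpectrum (𝓞 K), w ∉ S → ((M : ℕ) : 𝓞 K) ∉ w.asIdeal) :
    ∀ w : HeightOneSpectrum (𝓞 K), w ∉ S → ((p : ℕ) : 𝓞 K) ∉ w.asIdeal →
      ∀ σ : absoluteGaloisGroup (w.adicCompletion K), σ ∈ absInertia (w.adicCompletion K) →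
        ∀ a : Cofree Δ.ρ (padicCoeffField ι), Δ.cofreeRepOver K (absGaloisRestrict K (w.adicCompletion K) σ) a = a :=
  fun w hw hpw _σ hσ a => cofreeRepOver_apply_eq_self_of_mem_absInertia Δ K w (hSM w hw) hpw hσ a

end Member

end Summit.BirchSwinnertonDyer.Rank1Residual.X11b.RoadFFMember

end
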